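import Mathlib
import Summits.Ventures.HodgeRepro2.Tier7.Line3.AdicCompletionRestriction
import Summits.Ventures.HodgeRepro2.Tier7.Line3.AdicCompletionLevel
import Summits.Ventures.HodgeRepro2.Tier7.Line3.JointSupport

/-!
# Tier7/Line3/LevelKappaConversion — the `b`-side level tower feeds the κ-side `hsupp` at the real completion
(seat t7-x1, gen 5; the «conversion lemma in NEITHER file (in words until written)» of crit-2's precision (d),
STATUS l. 15918 / REPAIR CENSUS v18 (h⁗⁸), typed)

LINE 3 (t7-plan-3), version (ii). On the completion `F := wE.adicCompletion E` two absolute values coexist, each consumed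
by name on its own side (AdicCompletionRestriction, «TWO ABSOLUTE VALUES ON ONE FIELD»): the `b`-side level tower
`levelTower normAbv _ (one_lt_q wE) N = {g : ‖g − 1‖ ≤ (q wE)⁻¹ ^ (N+1)}` against Mathlib's NORMALISED norm `‖·‖`
(AdicCompletionLevel p705534, `q wE` the residue cardinality), and the κ-side `abvRoot v wE = ‖·‖ ^ (1/(e f))`
(AdicCompletionRestriction p706703), whose consumers `hcong_field_local_adic` read their level off a FREE real `q > 1`
through `abvRoot v wE ((k − 1) i j) ≤ q⁻¹ ^ N`. This module is the conversion between the two: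

* `qκ v wE := (q wE) ^ rootExp v wE` — the `(e f)`-th root of the residue cardinality — with `one_lt_qκ`;
* `abvRoot_le_of_norm_le : ‖x‖ ≤ (q wE)⁻¹ ^ n → abvRoot v wE x ≤ (qκ v wE)⁻¹ ^ n`
  (`Real.rpow_le_rpow`, `Real.rpow_natCast_mul` / `Real.rpow_mul_natCast`, `Real.inv_rpow`);
* `abvRoot_le_of_mem_levelTower : k ∈ levelTower normAbv _ (one_lt_q wE) N → ∀ i j, abvRoot v wE ((k − 1) i j) ≤ (qκ v wE)⁻¹ ^ N`
  — the tower's radius `(q wE)⁻¹ ^ (N+1) ≤ (q wE)⁻¹ ^ N` (JointSupport.radius_le): the `N+1` vs `N` shift absorbed;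
* `hsupp_adic_of_inSupport_levelTower`: the `b`-side support `InSupport (iotaA σ′) (iotaB σ′ f′) γ₀ (levelTower … N) γ`
  (LevelFactorData / ConcreteLevelFactor at the completion) gives KappaDataFinLocal's `hsupp` clause binder for binder
  at `q := qκ v wE`;
* THE CONSUMERS: `hcong_field_local_adic_of_levelTower` = p706703's `hcong_field_local_adic` with its `hsupp` REPLACED by
  the level-tower clause «`∃ k, IsTranslate σ′ f′ ((matO γ).map ψ) (γ₀w · k) ∧ ∀ i j, ‖(k − 1) i j‖ ≤ (q wE)⁻¹ ^ (N+1)`»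
  (the `b`-side radius, Mathlib's norm), conclusion `FinitePlace.mk v (κF γ − κF γ₀) ≤ (qκ v wE)⁻¹ ^ N`; and
  `hcong_field_local_adic_of_inSupport` — the same through the `InSupport` shape of JointSupport with
  `loc γ = (matO γ).map ψ` DISPLAYED (`hloc`), so that ONE `arith` (the level-`N` support in the group) feeds the κ-side
  congruence at the real completion, with the κ-side `q` of record `= qκ v wE`, no longer a parameter.

WHAT THIS CHANGES IN THE [W] COLUMN: «the κ-side `q` is abvRoot's own free real `q > 1`; the `b`-side tower's `‖·‖`-level
converts by `abvRoot = ‖·‖^{1/(ef)}`, i.e. `q_κ = (q w′)^{1/(ef)}` with the `N+1` vs `N` shift absorbed — a conversion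
lemma in NEITHER file (in words until written)» (crit-2 l. 15918 (d); census (h⁗⁸)) → a theorem; the κ-side `q` at the real
completion IS the `(e f)`-th root of the residue cardinality, read off the SAME tower as the `b`-side. At an inert place of
the quadratic `E/K` (`e f = 2`, AdicCompletionRestrictionDegree p707547) `qκ v wE = √(q wE)`.
DICTIONARY (in words): `K = E⁺`, `E` the CM field, `σ` its involution, `v = v₁` inert, `wE` the place above it,
`loc γ = (matO γ).map ψ` as a unit. Nothing here is about (N), (P), the real `X`, or HC_CM; §8(d): NO. Blind lane:
Mathlib + the HodgeRepro2 prefix; no sorry; axioms ⊆ {propext, Classical.choice, Quot.sound}.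
-/

namespace Summit.Ventures.HodgeRepro2.Tier7.Line3.LevelKappaConversion

open IsDedekindDomain IsDedekindDomain.HeightOneSpectrum NumberField Matrix
  Summit.Ventures.HodgeRepro2.Tier7.Line3.LevelTowerTopology
  Summit.Ventures.HodgeRepro2.Tier7.Line3.CongruenceSubgroup
  Summit.Ventures.HodgeRepro2.Tier7.Line3.AdicCompletionInvolution
  Summit.Ventures.HodgeRepro2.Tier7.Line3.AdicCompletionLevel
  Summit.Ventures.HodgeRepro2.Tier7.Line3.AdicCompletionRestriction
  Summit.Ventures.HodgeRepro2.Tier7.Line3.KappaDataFinLocal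
  Summit.Ventures.HodgeRepro2.Tier7.Line3.LevelInvariantOrbital
  Summit.Ventures.HodgeRepro2.Tier7.Line3.TorusSupport
  Summit.Ventures.HodgeRepro2.Tier7.Line3.JointSupport
  Summit.Ventures.HodgeRepro2.T7SupportTwoTorusInvariant
open scoped NumberField

variable {K E : Type*} [Field K] [NumberField K] [Field E] [NumberField E] [Algebra K E]
  (v : HeightOneSpectrum (𝓞 K)) (wE : HeightOneSpectrum (𝓞 E)) [wE.asIdeal.LiesOver v.asIdeal]

/-! ## The κ-side `q`: the `(e f)`-th root of the residue cardinality -/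

/-- **the κ-side level base** `qκ v wE := (q wE) ^ (1/(e f))`. -/
noncomputable def qκ : ℝ := (q wE) ^ rootExp v wE

omit [NumberField K] [wE.asIdeal.LiesOver v.asIdeal] in
/-- `qκ` on the nose. -/
theorem qκ_def : qκ v wE = (q wE) ^ rootExp v wE := rfl

/-- `1 < qκ v wE`. -/
theorem one_lt_qκ : 1 < qκ v wE :=
  Real.one_lt_rpow (one_lt_q wE) (rootExp_pos v wE)

/-- `0 < qκ v wE`. -/
theorem qκ_pos : 0 < qκ v wE := zero_lt_one.trans (one_lt_qκ v wE)

omit [NumberField K] [wE.asIdeal.LiesOver v.asIdeal] in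
/-- `(qκ v wE)⁻¹ = (q wE)⁻¹ ^ (1/(e f))`. -/
theorem qκ_inv : (qκ v wE)⁻¹ = (q wE)⁻¹ ^ rootExp v wE := by
  rw [qκ_def, Real.inv_rpow (q_pos wE).le]

/-! ## The conversion of the radius -/

/-- **the conversion of the radius**: `‖x‖ ≤ (q wE)⁻¹ ^ n` gives `abvRoot v wE x ≤ (qκ v wE)⁻¹ ^ n`. -/
theorem abvRoot_le_of_norm_le {x : wE.adicCompletion E} {n : ℕ} (h : ‖x‖ ≤ (q wE)⁻¹ ^ n) :
    abvRoot v wE x ≤ (qκ v wE)⁻¹ ^ n := by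
  rw [abvRoot_apply, qκ_inv, ← Real.rpow_mul_natCast (inv_nonneg.2 (q_pos wE).le), mul_comm,
    Real.rpow_natCast_mul (inv_nonneg.2 (q_pos wE).le)]
  exact Real.rpow_le_rpow (norm_nonneg x) h (rootExp_pos v wE).le

/-- **the level tower converts at its own level**: `k ∈ K_N` (the `b`-side tower at `q := q wE`, radius
`(q wE)⁻¹ ^ (N+1)`) gives the SHARP `abvRoot v wE ((k − 1) i j) ≤ (qκ v wE)⁻¹ ^ (N+1)` entrywise (crit-1 STATUS
l. 16087 (i)). -/
theorem abvRoot_le_of_mem_levelTower_succ (N : ℕ) (k : GL (Fin 2) (wE.adicCompletion E))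
    (hk : k ∈ levelTower normAbv isNonarchimedean_normAbv (one_lt_q wE) N) :
    ∀ i j, abvRoot v wE (((k : Matrix (Fin 2) (Fin 2) (wE.adicCompletion E)) - 1) i j) ≤
      (qκ v wE)⁻¹ ^ (N + 1) := by
  intro i j
  have h1 : EntryLE normAbv ((q wE)⁻¹ ^ (N + 1)) ((k : Matrix (Fin 2) (Fin 2) (wE.adicCompletion E)) - 1) := hk
  exact abvRoot_le_of_norm_le v wE (h1 i j)

/-- **the level tower converts with the `N+1` vs `N` shift absorbed**: `k ∈ K_N` gives
`abvRoot v wE ((k − 1) i j) ≤ (qκ v wE)⁻¹ ^ N` entrywise — the sharp `(N+1)` form of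
`abvRoot_le_of_mem_levelTower_succ` weakened once through `JointSupport.radius_le`; the loss of one power is the
CONSUMER's binder shape (KappaDataFinLocal's `hsupp` reads the radius `q⁻¹ ^ N` at level `N`), not a necessity
(crit-1 STATUS l. 16087 (i); plan-3 l. 16089 (1): the harmless direction — the tower's radius is the smaller one).
At `N = 0` the tower is the level-`𝔭` group and the conclusion reads `≤ 1`: non-vacuous and weak, no junk value
(`Real.rpow` never sees a negative base: `‖·‖ ≥ 0`, `q wE > 1`; crit-1 (iii)). -/
theorem abvRoot_le_of_mem_levelTower (N : ℕ) (k : GL (Fin 2) (wE.adicCompletion E))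
    (hk : k ∈ levelTower normAbv isNonarchimedean_normAbv (one_lt_q wE) N) :
    ∀ i j, abvRoot v wE (((k : Matrix (Fin 2) (Fin 2) (wE.adicCompletion E)) - 1) i j) ≤ (qκ v wE)⁻¹ ^ N :=
  fun i j => (abvRoot_le_of_mem_levelTower_succ v wE N k hk i j).trans (radius_le (one_lt_qκ v wE) N)

/-- the same for a matrix `k` with the level-tower entry bound displayed (the sharp form and the weakened one). -/
theorem abvRoot_le_of_entry_le_succ (N : ℕ) (k : Matrix (Fin 2) (Fin 2) (wE.adicCompletion E))
    (hk : ∀ i j, ‖(k - 1) i j‖ ≤ (q wE)⁻¹ ^ (N + 1)) :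
    ∀ i j, abvRoot v wE ((k - 1) i j) ≤ (qκ v wE)⁻¹ ^ (N + 1) := fun i j =>
  abvRoot_le_of_norm_le v wE (hk i j)

/-- the weakened matrix form (the consumer's binder shape). -/
theorem abvRoot_le_of_entry_le (N : ℕ) (k : Matrix (Fin 2) (Fin 2) (wE.adicCompletion E))
    (hk : ∀ i j, ‖(k - 1) i j‖ ≤ (q wE)⁻¹ ^ (N + 1)) :
    ∀ i j, abvRoot v wE ((k - 1) i j) ≤ (qκ v wE)⁻¹ ^ N := fun i j =>
  (abvRoot_le_of_entry_le_succ v wE N k hk i j).trans (radius_le (one_lt_qκ v wE) N)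

/-! ## The `b`-side support gives the κ-side `hsupp` clause at `q := qκ v wE` -/

variable (σ : E →+* E) (hσ : ∀ x, wE.valuation E (σ x) = wE.valuation E x)

/-- **the `b`-side level support gives KappaDataFinLocal's `hsupp` clause at the real completion, at `q := qκ v wE`**:
`γ ∈ ι_A(A) γ₀ K_N ι_B(B)` (the tower at `q := q wE`) implies
`∃ k, IsTranslate σ′ f′ γ (γ₀ · k) ∧ ∀ i j, abvRoot v wE ((k − 1) i j) ≤ (qκ v wE)⁻¹ ^ N`.
The one non-arithmetic step (plan-3 STATUS l. 16089 (2)) — from the group-level `InSupport` (`∃ tA tB, ∃ k ∈ K_N,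
γ = (iotaA tA)⁻¹ γ₀ k (iotaB tB)` in `GL (Fin 2) F`) to the matrix-level `IsTranslate σ′ f′ γ (γ₀ · k)` with the
torus witnesses carried over and `k` coerced `GL → Matrix` — is the LANDED `TorusSupport.isTranslate_of_inSupport`
(p695064), exactly as JointSupport.hsupp_of_inSupport_levelTower (p696095) uses it. -/
theorem hsupp_adic_of_inSupport_levelTower (f' : Fin 2 → Fin 2 → wE.adicCompletion E) (N : ℕ)
    (γ₀ γ : GL (Fin 2) (wE.adicCompletion E))
    (h : InSupport (iotaA (completionMap wE σ hσ)) (iotaB (completionMap wE σ hσ) f') γ₀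
      (levelTower normAbv isNonarchimedean_normAbv (one_lt_q wE) N) γ) :
    ∃ k : Matrix (Fin 2) (Fin 2) (wE.adicCompletion E),
      IsTranslate (completionMap wE σ hσ) f' (γ : Matrix (Fin 2) (Fin 2) (wE.adicCompletion E))
          ((γ₀ : Matrix (Fin 2) (Fin 2) (wE.adicCompletion E)) * k) ∧
        ∀ i j, abvRoot v wE ((k - 1) i j) ≤ (qκ v wE)⁻¹ ^ N := by
  obtain ⟨k, hk, ht⟩ := isTranslate_of_inSupport (completionMap wE σ hσ) f' _ γ₀ γ h
  refine ⟨(k : Matrix (Fin 2) (Fin 2) (wE.adicCompletion E)), by rwa [Units.val_mul] at ht, ?_⟩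
  exact abvRoot_le_of_mem_levelTower v wE N k hk

/-! ## The consumers: `hcong` at the real completion with the level read off the `b`-side tower -/

variable (d : Fin 2 → E) (f : Fin 2 → Fin 2 → E) {Orb : Type*} (matO : Orb → Matrix (Fin 2) (Fin 2) E)
  (κF : Orb → K) (arith : ℕ → Orb → Prop) (γ₀ : Orb)

/-- **`hcong` at the real completion, the level read off the `b`-side tower**: p706703's `hcong_field_local_adic` with
the `hsupp` clause stated against Mathlib's norm at the tower's radius `(q wE)⁻¹ ^ (N+1)` (every other binder
identical); the κ-side `q` is `qκ v wE = (q wE)^{1/(e f)}`. That «the same tower is read on both sides» is a theorem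
and not a convention rests on `AdicCompletionRestriction.finitePlace_eq_abvRoot` (p706703): `abvRoot v wE` restricted
to `K` IS the place `FinitePlace.mk v` — the discharge of KappaDataFinLocal's `hw` (and `hψ` by
`embedding_apply_eq_completionMap`) on this `F`, inside `hcong_field_local_adic` (crit-1 STATUS l. 16087 (ii)). -/
theorem hcong_field_local_adic_of_levelTower
    (hκ : ∀ γ, algebraMap K E (κF γ) = kappa σ d f (matO γ))
    (hf : ∀ i, abvRoot v wE (FinitePlace.embedding wE (f 0 i)) ≤ 1)
    (hd : abvRoot v wE (FinitePlace.embedding wE (d 0)) ≤ 1)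
    (hdisc : abvRoot v wE (FinitePlace.embedding wE (d 0) *
      disc' (completionMap wE σ hσ) (fun i => FinitePlace.embedding wE (d i))
        (fun j i => FinitePlace.embedding wE (f j i)) 0) = 1)
    (γ₀w : Matrix (Fin 2) (Fin 2) (wE.adicCompletion E))
    (hγ₀ : IsTranslate (completionMap wE σ hσ) (fun j i => FinitePlace.embedding wE (f j i))
      ((matO γ₀).map (FinitePlace.embedding wE)) γ₀w)
    (hγ₀int : ∀ i j, abvRoot v wE (γ₀w i j) ≤ 1)
    (hsupp : ∀ N γ, arith N γ → ∃ k : Matrix (Fin 2) (Fin 2) (wE.adicCompletion E),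
      IsTranslate (completionMap wE σ hσ) (fun j i => FinitePlace.embedding wE (f j i))
        ((matO γ).map (FinitePlace.embedding wE)) (γ₀w * k) ∧ ∀ i j, ‖(k - 1) i j‖ ≤ (q wE)⁻¹ ^ (N + 1)) :
    ∀ N γ, arith N γ → FinitePlace.mk v (κF γ - κF γ₀) ≤ (qκ v wE)⁻¹ ^ N :=
  hcong_field_local_adic v wE σ hσ d f matO κF arith γ₀ hκ hf hd hdisc (one_lt_qκ v wE) γ₀w hγ₀ hγ₀int
    fun N γ hγ => by
      obtain ⟨k, hk, hkN⟩ := hsupp N γ hγ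
      exact ⟨k, hk, abvRoot_le_of_entry_le v wE N k hkN⟩

/-- the local torus translate is reflexive (`a = b = 1`, `t′ = 1`). -/
theorem isTranslate_self (σ' : wE.adicCompletion E →+* wE.adicCompletion E)
    (f' : Fin 2 → Fin 2 → wE.adicCompletion E) (m : Matrix (Fin 2) (Fin 2) (wE.adicCompletion E)) :
    IsTranslate σ' f' m m :=
  ⟨fun _ => 1, fun _ => 1, 1, by simp [nrm], by simp [nrm], actsOn_one f', by simp⟩

/-- **ONE `arith` feeds the κ-side congruence at the real completion**: with `loc γ = (matO γ).map ψ` displayed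
(`hloc`) and the support `arith N γ → InSupport (iotaA σ′) (iotaB σ′ f′) (loc γ₀) (levelTower … N) (loc γ)` of
JointSupport / LevelFactorData at the completion, `FinitePlace.mk v (κF γ − κF γ₀) ≤ (qκ v wE)⁻¹ ^ N`. -/
theorem hcong_field_local_adic_of_inSupport
    (hκ : ∀ γ, algebraMap K E (κF γ) = kappa σ d f (matO γ))
    (hf : ∀ i, abvRoot v wE (FinitePlace.embedding wE (f 0 i)) ≤ 1)
    (hd : abvRoot v wE (FinitePlace.embedding wE (d 0)) ≤ 1)
    (hdisc : abvRoot v wE (FinitePlace.embedding wE (d 0) *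
      disc' (completionMap wE σ hσ) (fun i => FinitePlace.embedding wE (d i))
        (fun j i => FinitePlace.embedding wE (f j i)) 0) = 1)
    (loc : Orb → GL (Fin 2) (wE.adicCompletion E))
    (hloc : ∀ γ, ((loc γ : GL (Fin 2) (wE.adicCompletion E)) : Matrix (Fin 2) (Fin 2) (wE.adicCompletion E)) =
      (matO γ).map (FinitePlace.embedding wE))
    (hγ₀int : ∀ i j, abvRoot v wE (((loc γ₀ : GL (Fin 2) (wE.adicCompletion E)) :
      Matrix (Fin 2) (Fin 2) (wE.adicCompletion E)) i j) ≤ 1)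
    (hsupp : ∀ N γ, arith N γ → InSupport (iotaA (completionMap wE σ hσ))
      (iotaB (completionMap wE σ hσ) (fun j i => FinitePlace.embedding wE (f j i))) (loc γ₀)
      (levelTower normAbv isNonarchimedean_normAbv (one_lt_q wE) N) (loc γ)) :
    ∀ N γ, arith N γ → FinitePlace.mk v (κF γ - κF γ₀) ≤ (qκ v wE)⁻¹ ^ N :=
  hcong_field_local_adic v wE σ hσ d f matO κF arith γ₀ hκ hf hd hdisc (one_lt_qκ v wE)
    ((loc γ₀ : GL (Fin 2) (wE.adicCompletion E)) : Matrix (Fin 2) (Fin 2) (wE.adicCompletion E))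
    (by rw [← hloc γ₀]; exact isTranslate_self wE _ _ _) hγ₀int
    fun N γ hγ => by
      obtain ⟨k, hk, hkN⟩ := hsupp_adic_of_inSupport_levelTower v wE σ hσ
        (fun j i => FinitePlace.embedding wE (f j i)) N (loc γ₀) (loc γ) (hsupp N γ hγ)
      exact ⟨k, by rwa [hloc γ] at hk, hkN⟩

end Summit.Ventures.HodgeRepro2.Tier7.Line3.LevelKappaConversion
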